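import Literature.Barriers.BirchSwinnertonDyer.RankNotSumOfLocalInvariantsF4Places
import Literature.Barriers.BirchSwinnertonDyer.RankNotSumOfLocalInvariantsProofs
import Mathlib.LinearAlgebra.FreeModule.IdealQuotient
import Mathlib.FieldTheory.Galois.IsGaloisGroup
import Mathlib.RingTheory.DedekindDomain.Ideal.Lemmas
import Mathlib.RingTheory.Invariant.Basic
import Mathlib.FieldTheory.Finite.Basic
import HarnessLib

/-!
# Places of `F₄ = ℚ(√-1, √41, √73)`, II: `4 ∣ #{w ∣ v}`, and the descent leaf of Theorem 2 (`n = 4`)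

Conclusion of `RankNotSumOfLocalInvariantsF4Field.lean` / `…F4Places.lean`. For the concrete
model `DokchitserDokchitser2011.F4` of `F₄ = ℚ(√-1, √41, √73)` we prove the splitting hypothesis
of Lemma 3 of Dokchitser–Dokchitser (2011) at the finite places and reduce the named fact
`Literature.Barriers.BirchSwinnertonDyer.DokchitserDokchitser2011_rank_480a1_F4` (the `n = 4`
case of the proof of Thm. 2, vendored in `RankNotSumOfLocalInvariantsProofs.lean`) to the one
statement that is a computer calculation in the source:

* `F4.card_stabilizer_le_two`: every decomposition group `D_P ≤ Gal(F4/ℚ)` (`P` a non-zero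
  prime of `𝓞 F4`) has order `≤ 2`. If `2 ∈ P` (resp. `41 ∈ P`, `73 ∈ P`) every `ρ ∈ D_P`
  fixes two of `√-1, √41, √73` (the residue trick of part I), and an automorphism is determined
  by its three signs, so `D_P` has at most one non-trivial element; otherwise the inertia group
  is trivial (`F4.eq_one_of_inertia`), so `D_P` embeds (Mathlib `Ideal.Quotient.stabilizerHom`,
  kernel = inertia) into the Galois group of the finite residue field extension, which is
  cyclic, and `D_P` has exponent `2` (`F4.algEquiv_mul_self`), hence order `≤ 2`.
* `F4.four_dvd_card_heightOneSpectrum`: by transitivity of `Gal(F4/ℚ)` on the primes above `v`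
  (Mathlib `Algebra.IsInvariant.orbit_eq_primesOver`) and orbit–stabiliser, their number is
  `8 / |D_P| ∈ {4, 8}`.
* `DokchitserDokchitser2011_descent_480a1_F4` (named fact, the Magma leaf): "2-descent shows
  that `rk E/F₄ = 6`" for `E = 480a1`, stated for the concrete `F4`.
* `DokchitserDokchitser2011_rank_480a1_F4_of_descent`: the tree's named fact
  `DokchitserDokchitser2011_rank_480a1_F4` follows from the descent leaf alone — its
  field-theoretic conjuncts (Galois, degree `8`, `√-1, √41, √73 ∈ F`, `4 ∣ #{w ∣ v}` for all
  finite and infinite `v`) are theorems.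

What is NOT here: the rank computation itself (`rk_ℤ E(F₄) = 6` needs the Mordell–Weil theorem
and a verified `2`-descent over a degree-`8` field; neither exists in Lean), and the analogous
leaves for `F₃`, `F₅` (degree `9` and `25` subfields of cyclotomic fields).

## References

* T. Dokchitser, V. Dokchitser, *A note on the Mordell–Weil rank modulo `n`*, J. Number Theory
  131 (2011) 1833–1839, arXiv:0910.4588, Lemma 3 and proof of Thm. 2 ("`F₄` […] satisf[ies] the
  assumptions of Lemma 3 with `n = 4` […] 2-descent shows that […] `rk E/F₄ = 6` (e.g. using
  Magma, over all minimal non-trivial subfields of `F_n`)"). [DokchitserDokchitser2011RankModN]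
-/

noncomputable section

open QuadraticAlgebra

namespace Literature.Barriers.BirchSwinnertonDyer.DokchitserDokchitser2011

open NumberField IsDedekindDomain Polynomial
open scoped Pointwise

/-- **Decomposition groups in `F4/ℚ` have order `≤ 2`.** For every non-zero prime `P` of
`𝓞 F4`, the stabiliser of `P` in `Gal(F4/ℚ)` has at most two elements: if `2 ∈ P` (resp.
`41 ∈ P`, `73 ∈ P`) every element of the stabiliser fixes `√41, √73` (resp. `√-1, √73`;
`√-1, √41`), so two non-trivial elements agree on all three square roots; otherwise the inertia
subgroup is trivial (`F4.eq_one_of_inertia`), so the stabiliser embeds into the Galois group of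
the (finite) residue field extension, which is cyclic, and a cyclic group of exponent `2` has
order `≤ 2`. [folklore] -/
theorem F4.card_stabilizer_le_two (P : Ideal (𝓞 F4)) [P.IsPrime] (hP : P ≠ ⊥) :
    Nat.card (MulAction.stabilizer (F4 ≃ₐ[ℚ] F4) P) ≤ 2 := by
  by_cases h2 : (2 : 𝓞 F4) ∈ P
  · refine Subgroup.card_le_two_of fun σ hσ τ hτ hσ1 hτ1 => ?_
    rw [MulAction.mem_stabilizer_iff] at hσ hτ
    have hb := fun (ρ : F4 ≃ₐ[ℚ] F4) (hρ : ρ • P = P) => F4.apply_rt41_of_two_mem h2 hρ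
    have hc := fun (ρ : F4 ≃ₐ[ℚ] F4) (hρ : ρ • P = P) => F4.apply_rt73_of_two_mem h2 hρ
    have nσ : σ F4.rtm1 = -F4.rtm1 := (F4.algEquiv_rtm1 σ).resolve_left fun h =>
      hσ1 (F4.algEquiv_eq_one h (hb σ hσ) (hc σ hσ))
    have nτ : τ F4.rtm1 = -F4.rtm1 := (F4.algEquiv_rtm1 τ).resolve_left fun h =>
      hτ1 (F4.algEquiv_eq_one h (hb τ hτ) (hc τ hτ))
    exact F4.algEquiv_eq_of_apply_eq (nσ.trans nτ.symm) ((hb σ hσ).trans (hb τ hτ).symm)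
      ((hc σ hσ).trans (hc τ hτ).symm)
  by_cases h41 : (41 : 𝓞 F4) ∈ P
  · refine Subgroup.card_le_two_of fun σ hσ τ hτ hσ1 hτ1 => ?_
    rw [MulAction.mem_stabilizer_iff] at hσ hτ
    have ha := fun (ρ : F4 ≃ₐ[ℚ] F4) (hρ : ρ • P = P) => F4.apply_rtm1_of_41_mem h41 hρ
    have hc := fun (ρ : F4 ≃ₐ[ℚ] F4) (hρ : ρ • P = P) => F4.apply_rt73_of_41_mem h41 hρ
    have nσ : σ F4.rt41 = -F4.rt41 := (F4.algEquiv_rt41 σ).resolve_left fun h =>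
      hσ1 (F4.algEquiv_eq_one (ha σ hσ) h (hc σ hσ))
    have nτ : τ F4.rt41 = -F4.rt41 := (F4.algEquiv_rt41 τ).resolve_left fun h =>
      hτ1 (F4.algEquiv_eq_one (ha τ hτ) h (hc τ hτ))
    exact F4.algEquiv_eq_of_apply_eq ((ha σ hσ).trans (ha τ hτ).symm) (nσ.trans nτ.symm)
      ((hc σ hσ).trans (hc τ hτ).symm)
  by_cases h73 : (73 : 𝓞 F4) ∈ P
  · refine Subgroup.card_le_two_of fun σ hσ τ hτ hσ1 hτ1 => ?_
    rw [MulAction.mem_stabilizer_iff] at hσ hτ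
    have ha := fun (ρ : F4 ≃ₐ[ℚ] F4) (hρ : ρ • P = P) => F4.apply_rtm1_of_73_mem h73 hρ
    have hb := fun (ρ : F4 ≃ₐ[ℚ] F4) (hρ : ρ • P = P) => F4.apply_rt41_of_73_mem h73 hρ
    have nσ : σ F4.rt73 = -F4.rt73 := (F4.algEquiv_rt73 σ).resolve_left fun h =>
      hσ1 (F4.algEquiv_eq_one (ha σ hσ) (hb σ hσ) h)
    have nτ : τ F4.rt73 = -F4.rt73 := (F4.algEquiv_rt73 τ).resolve_left fun h =>
      hτ1 (F4.algEquiv_eq_one (ha τ hτ) (hb τ hτ) h)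
    exact F4.algEquiv_eq_of_apply_eq ((ha σ hσ).trans (ha τ hτ).symm)
      ((hb σ hσ).trans (hb τ hτ).symm) (nσ.trans nτ.symm)
  -- the unramified case: trivial inertia, cyclic decomposition group of exponent 2
  · classical
    haveI : P.IsMaximal := Ideal.IsPrime.isMaximal ‹_› hP
    letI : Field (𝓞 F4 ⧸ P) := Ideal.Quotient.field P
    letI : Field (𝓞 ℚ ⧸ P.under (𝓞 ℚ)) := Ideal.Quotient.field _
    haveI : Finite (𝓞 F4 ⧸ P) := Ideal.finiteQuotientOfFreeOfNeBot P hP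
    have hinj : Function.Injective
        (Ideal.Quotient.stabilizerHom P (P.under (𝓞 ℚ)) (F4 ≃ₐ[ℚ] F4)) := by
      rw [← MonoidHom.ker_eq_bot_iff, Ideal.Quotient.ker_stabilizerHom, eq_bot_iff]
      rintro ⟨ρ, hρ⟩ hin
      rw [Subgroup.mem_bot, Subgroup.mk_eq_one]
      exact F4.eq_one_of_inertia h2 h41 h73 fun x => by simpa using hin x
    haveI := isCyclic_of_injective _ hinj
    have hexp : Monoid.exponent (MulAction.stabilizer (F4 ≃ₐ[ℚ] F4) P) ∣ 2 :=
      Monoid.exponent_dvd_of_forall_pow_eq_one fun g =>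
        Subtype.ext (by rw [pow_two]; exact F4.algEquiv_mul_self g.1)
    rw [IsCyclic.exponent_eq_card] at hexp
    exact Nat.le_of_dvd two_pos hexp

/-- **`F4` satisfies the hypothesis of Lemma 3 at the finite places, `n = 4`**: over every finite
place `v` of `ℚ` the number of places of `F4 = ℚ(√-1, √41, √73)` is a multiple of `4` (it is
`8 / |D_P| ∈ {4, 8}` by `F4.card_stabilizer_le_two`, orbit–stabiliser and transitivity of
`Gal(F4/ℚ)` on the primes above `v`). [cite: DokchitserDokchitser2011RankModN, proof of Thm. 2] -/
theorem F4.four_dvd_card_heightOneSpectrum (v : HeightOneSpectrum (𝓞 ℚ)) :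
    4 ∣ Nat.card {w : HeightOneSpectrum (𝓞 F4) // w.under (𝓞 ℚ) = v} := by
  classical
  rcases isEmpty_or_nonempty {w : HeightOneSpectrum (𝓞 F4) // w.under (𝓞 ℚ) = v} with h | ⟨⟨w₀, hw₀⟩⟩
  · rw [Nat.card_of_isEmpty]
    exact dvd_zero 4
  · haveI : w₀.asIdeal.IsPrime := w₀.isPrime
    haveI : w₀.asIdeal.LiesOver v.asIdeal := ⟨by rw [← hw₀]; rfl⟩
    have e : {w : HeightOneSpectrum (𝓞 F4) // w.under (𝓞 ℚ) = v} ≃ v.asIdeal.primesOver (𝓞 F4) :=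
      { toFun := fun w => ⟨w.1.asIdeal, w.1.isPrime, ⟨(congrArg HeightOneSpectrum.asIdeal w.2).symm⟩⟩
        invFun := fun Q => ⟨⟨Q.1, Q.2.1, Ideal.ne_bot_of_mem_primesOver v.ne_bot Q.2⟩,
          HeightOneSpectrum.ext Q.2.2.over.symm⟩
        left_inv := fun w => rfl
        right_inv := fun Q => rfl }
    rw [Nat.card_congr e, Nat.card_coe_set_eq, ← Algebra.IsInvariant.orbit_eq_primesOver (𝓞 ℚ)
      (𝓞 F4) (F4 ≃ₐ[ℚ] F4) v.asIdeal w₀.asIdeal, ← MulAction.index_stabilizer]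
    have hmul := Subgroup.card_mul_index (MulAction.stabilizer (F4 ≃ₐ[ℚ] F4) w₀.asIdeal)
    rw [F4.card_algEquiv] at hmul
    have hle := F4.card_stabilizer_le_two w₀.asIdeal w₀.ne_bot
    have hpos : 0 < Nat.card (MulAction.stabilizer (F4 ≃ₐ[ℚ] F4) w₀.asIdeal) := Nat.card_pos
    interval_cases Nat.card (MulAction.stabilizer (F4 ≃ₐ[ℚ] F4) w₀.asIdeal) <;> omega


end Literature.Barriers.BirchSwinnertonDyer.DokchitserDokchitser2011

namespace Literature.Barriers.BirchSwinnertonDyer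

open NumberField IsDedekindDomain WeierstrassCurve DokchitserDokchitser2011

/-- **Descent leaf, `n = 4`** (named fact; the Magma computation in the proof of Theorem 2 of
Dokchitser–Dokchitser 2011): "2-descent shows that `rk E/F₄ = 6` (e.g. using Magma, over all
minimal non-trivial subfields of `F_n`)" for `E = 480a1 : y² = x(x+2)(x-3)` and
`F₄ = ℚ(√-1, √41, √73)`, here the concrete model `DokchitserDokchitser2011.F4` (generated over `ℚ`
by `rtm1² = -1`, `rt41² = 41`, `rt73² = 73`, of degree `8`: `F4.adjoin_eq_top`, `F4.finrank_eq`).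
Formally `rank_ℤ E(F4) = 6` for `WeierstrassCurve.mordellWeilRank = finrank ℤ E(F4)`. This is the
only unproved input of `DokchitserDokchitser2011_rank_480a1_F4` (theorem
`DokchitserDokchitser2011_rank_480a1_F4_of_descent`): a `2`-descent over a number field of
degree `8` together with the Mordell–Weil theorem, neither available in Lean.
[cite: DokchitserDokchitser2011RankModN, proof of Thm. 2] -/
def DokchitserDokchitser2011_descent_480a1_F4 : Prop :=
  (curve480a1.baseChange F4).mordellWeilRank = 6

/-- **`DokchitserDokchitser2011_rank_480a1_F4` from the descent leaf.** The field-theoretic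
content of the named fact — `F₄ = ℚ(√-1, √41, √73)` is a Galois number field of degree `8`
containing `√-1, √41, √73` in which the number of places above every place of `ℚ`, finite or
infinite, is a multiple of `4` — is PROVED (`F4.isGalois`, `F4.finrank_eq`,
`F4.four_dvd_card_heightOneSpectrum`, `F4.four_dvd_card_infinitePlace`); the Mordell–Weil rank
`rk E(F₄) = 6` is the hypothesis `h`. [cite: DokchitserDokchitser2011RankModN, proof of Thm. 2] -/
theorem DokchitserDokchitser2011_rank_480a1_F4_of_descent
    (h : DokchitserDokchitser2011_descent_480a1_F4) : DokchitserDokchitser2011_rank_480a1_F4 :=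
  ⟨F4, inferInstance, inferInstance, F4.isGalois, F4.finrank_eq,
    ⟨F4.rtm1, F4.rt41, F4.rt73, F4.rtm1_sq, F4.rt41_sq, F4.rt73_sq⟩,
    F4.four_dvd_card_heightOneSpectrum, F4.four_dvd_card_infinitePlace, h⟩


end Literature.Barriers.BirchSwinnertonDyer

end
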